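import Mathlib
import HarnessLib
import Summits.Ventures.LatticeQCDFlow.Scoring.SU3TraceLowerBound

/-!
# The Frobenius diameter of `SU(3)` is `3`: `Σᵢⱼ |Uᵢⱼ − Vᵢⱼ|² = 6 − 2 Re tr(U V†) ≤ 9`, with equality iff `V = ζ U` for a non-trivial cube root of unity `ζ`

HONEST FRAMING: exact (Metropolis-corrected) sampling algorithms for lattice gauge theory;
figures of merit are autocorrelation/cost numbers at stated couplings and volumes; no
continuum-physics claim.

Venture `LatticeQCDFlow` (cell pub-lqcd), sub-topic `Scoring`; FANOUT row 21 (`su3-base`: the 4D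
`SU(3)` baselines; link-by-link comparisons of two implementations / two runs, the cooling and
reunitarisation checks of CARD §13, are Frobenius distances between `SU(3)` matrices).  NEW WORK of
the cell (placement rule), elementary, over row 21 GEN-8's `Scoring/SU3TraceLowerBound`
(`neg_three_halves_le_reTr`, `reTr_eq_neg_three_halves_iff`, `reTr_eq_three_iff`); no definition is
introduced; nothing is cited as a fact; no number of ours.

For unitary `3 × 3` matrices the squared Frobenius distance is an affine function of ONE class
function of the "ratio" `U V† ∈ SU(3)`:

  `Σᵢⱼ |Uᵢⱼ − Vᵢⱼ|² = 6 − 2 Re tr(U V†)`.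

With `−3/2 ≤ Re tr W ≤ 3` on `SU(3)` this gives `0 ≤ Σ|U − V|² ≤ 9`: the Frobenius DIAMETER of
`SU(3)` is `3` (not the `2√3` of `U(3)`, where `V = −U` is allowed), attained exactly when
`U V† = ζ·1` with `ζ` a non-trivial cube root of unity, i.e. `U = ζ V`: the farthest points from a
link are its two non-trivial centre translates.  The distance vanishes iff `Re tr(U V†) = 3` iff
`U = V`.

## What is proved (`U, V ∈ SU(3)` as elements of `Matrix.specialUnitaryGroup (Fin 3) ℂ`)

* `sum_normSq_entries_eq_three` — `Σᵢⱼ |Uᵢⱼ|² = 3` (`= Re tr(U U†)`);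
  **`su3_frobeniusDistSq_eq`** — `Σᵢⱼ |Uᵢⱼ − Vᵢⱼ|² = 6 − 2 Re tr(U V⁻¹)`;
* **`su3_frobeniusDistSq_le_nine`** — `Σᵢⱼ |Uᵢⱼ − Vᵢⱼ|² ≤ 9`;
  **`su3_frobeniusDistSq_eq_nine_iff`** — `= 9 ⇔ ∃ ζ, ζ³ = 1 ∧ ζ ≠ 1 ∧ U = ζ • V`;
  `su3_frobeniusDistSq_eq_zero_iff` — `= 0 ⇔ U = V` (via `Re tr(U V⁻¹) = 3 ⇔ U V⁻¹ = 1`);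
* `su3_frobeniusDistSq_one_le_nine`, `su3_frobeniusDistSq_one_eq_nine_iff` — the special case
  `V = 1`: `Σ|U − 1|² = 6 − 2 Re tr U ≤ 9`, `= 9` iff `U` is a non-trivial centre element.

NOT CLAIMED: any statement about geodesic (bi-invariant Riemannian) distances on `SU(3)`; anything
for `N ≠ 3`.
-/

namespace Summit.Ventures.LatticeQCDFlow.Scoring

open Matrix Complex
open Literature.MathematicalPhysics.QuantumLattice

section SpecialUnitaryThree

/-- `Re tr (A B†) = Σᵢⱼ Re (Aᵢⱼ conj Bᵢⱼ)` for `3 × 3` complex matrices. -/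
theorem re_trace_mul_star_eq_sum (A B : Matrix (Fin 3) (Fin 3) ℂ) :
    ((A * star B).trace).re = ∑ i, ∑ j, (A i j * (starRingEnd ℂ) (B i j)).re := by
  rw [Matrix.trace]
  simp only [Matrix.diag_apply, Matrix.mul_apply, star_eq_conjTranspose, conjTranspose_apply,
    Complex.star_def, Complex.re_sum]

/-- `Σᵢⱼ |Uᵢⱼ|² = 3` for `U ∈ SU(3)` (the rows are unit vectors: `U U† = 1`). -/
theorem sum_normSq_entries_eq_three (U : Matrix.specialUnitaryGroup (Fin 3) ℂ) :
    ∑ i, ∑ j, ‖(U : Matrix (Fin 3) (Fin 3) ℂ) i j‖ ^ 2 = 3 := by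
  have hU : (U : Matrix (Fin 3) (Fin 3) ℂ) * star (U : Matrix (Fin 3) (Fin 3) ℂ) = 1 :=
    Unitary.mul_star_self_of_mem U.2.1
  have h := re_trace_mul_star_eq_sum (U : Matrix (Fin 3) (Fin 3) ℂ) (U : Matrix (Fin 3) (Fin 3) ℂ)
  rw [hU, Matrix.trace_one, Fintype.card_fin] at h
  have h3 : ((3 : ℕ) : ℂ).re = 3 := by simp
  rw [h3] at h
  rw [h]
  refine Finset.sum_congr rfl fun i _ => Finset.sum_congr rfl fun j _ => ?_
  rw [Complex.mul_conj, Complex.ofReal_re, Complex.normSq_eq_norm_sq]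

/-- **The squared Frobenius distance on `SU(3)` is affine in `Re tr(U V⁻¹)`**:
`Σᵢⱼ |Uᵢⱼ − Vᵢⱼ|² = 6 − 2 Re tr(U V⁻¹)`. -/
theorem su3_frobeniusDistSq_eq (U V : Matrix.specialUnitaryGroup (Fin 3) ℂ) :
    ∑ i, ∑ j, ‖(U : Matrix (Fin 3) (Fin 3) ℂ) i j - (V : Matrix (Fin 3) (Fin 3) ℂ) i j‖ ^ 2
      = 6 - 2 * reTr (U * V⁻¹) := by
  have hre : reTr (U * V⁻¹) = ∑ i, ∑ j, ((U : Matrix (Fin 3) (Fin 3) ℂ) i j *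
      (starRingEnd ℂ) ((V : Matrix (Fin 3) (Fin 3) ℂ) i j)).re := by
    change (((U : Matrix (Fin 3) (Fin 3) ℂ) * star (V : Matrix (Fin 3) (Fin 3) ℂ)).trace).re = _
    exact re_trace_mul_star_eq_sum _ _
  have hU := sum_normSq_entries_eq_three U
  have hV := sum_normSq_entries_eq_three V
  -- entrywise: `|a − b|² = |a|² + |b|² − 2 Re(a conj b)`
  have hent : ∀ a b : ℂ, ‖a - b‖ ^ 2 = ‖a‖ ^ 2 + ‖b‖ ^ 2 - 2 * (a * (starRingEnd ℂ) b).re := by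
    intro a b
    rw [Complex.sq_norm, Complex.sq_norm, Complex.sq_norm, Complex.normSq_apply, Complex.normSq_apply,
      Complex.normSq_apply]
    simp only [Complex.sub_re, Complex.sub_im, Complex.mul_re, Complex.conj_re, Complex.conj_im]
    ring
  simp_rw [hent, Finset.sum_sub_distrib, Finset.sum_add_distrib, ← Finset.mul_sum]
  rw [hU, hV, hre]
  ring

/-- **The Frobenius diameter of `SU(3)` is `3`**: `Σᵢⱼ |Uᵢⱼ − Vᵢⱼ|² ≤ 9`. -/
theorem su3_frobeniusDistSq_le_nine (U V : Matrix.specialUnitaryGroup (Fin 3) ℂ) :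
    ∑ i, ∑ j, ‖(U : Matrix (Fin 3) (Fin 3) ℂ) i j - (V : Matrix (Fin 3) (Fin 3) ℂ) i j‖ ^ 2 ≤ 9 := by
  rw [su3_frobeniusDistSq_eq]
  have h := neg_three_halves_le_reTr (U * V⁻¹)
  linarith

/-- **The diameter is attained exactly at non-trivial centre translates**:
`Σ|U − V|² = 9 ⇔ U = ζ • V` with `ζ³ = 1`, `ζ ≠ 1`. -/
theorem su3_frobeniusDistSq_eq_nine_iff (U V : Matrix.specialUnitaryGroup (Fin 3) ℂ) :
    ∑ i, ∑ j, ‖(U : Matrix (Fin 3) (Fin 3) ℂ) i j - (V : Matrix (Fin 3) (Fin 3) ℂ) i j‖ ^ 2 = 9 ↔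
      ∃ ζ : ℂ, ζ ^ 3 = 1 ∧ ζ ≠ 1 ∧
        (U : Matrix (Fin 3) (Fin 3) ℂ) = ζ • (V : Matrix (Fin 3) (Fin 3) ℂ) := by
  rw [su3_frobeniusDistSq_eq]
  have key : reTr (U * V⁻¹) = -(3 / 2 : ℝ) ↔ ∃ ζ : ℂ, ζ ^ 3 = 1 ∧ ζ ≠ 1 ∧
      (U : Matrix (Fin 3) (Fin 3) ℂ) = ζ • (V : Matrix (Fin 3) (Fin 3) ℂ) := by
    rw [reTr_eq_neg_three_halves_iff]
    have hVV : star (V : Matrix (Fin 3) (Fin 3) ℂ) * (V : Matrix (Fin 3) (Fin 3) ℂ) = 1 :=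
      Unitary.star_mul_self_of_mem V.2.1
    have hVV' : (V : Matrix (Fin 3) (Fin 3) ℂ) * star (V : Matrix (Fin 3) (Fin 3) ℂ) = 1 :=
      Unitary.mul_star_self_of_mem V.2.1
    constructor
    · rintro ⟨ζ, h3, h1, hUV⟩
      refine ⟨ζ, h3, h1, ?_⟩
      change (U : Matrix (Fin 3) (Fin 3) ℂ) * star (V : Matrix (Fin 3) (Fin 3) ℂ) = _ at hUV
      calc (U : Matrix (Fin 3) (Fin 3) ℂ)
          = ((U : Matrix (Fin 3) (Fin 3) ℂ) * star (V : Matrix (Fin 3) (Fin 3) ℂ)) *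
              (V : Matrix (Fin 3) (Fin 3) ℂ) := by rw [Matrix.mul_assoc, hVV, Matrix.mul_one]
        _ = ζ • (V : Matrix (Fin 3) (Fin 3) ℂ) := by rw [hUV, Matrix.smul_mul, Matrix.one_mul]
    · rintro ⟨ζ, h3, h1, hUV⟩
      refine ⟨ζ, h3, h1, ?_⟩
      change (U : Matrix (Fin 3) (Fin 3) ℂ) * star (V : Matrix (Fin 3) (Fin 3) ℂ) = _
      rw [hUV, Matrix.smul_mul, hVV']
  constructor
  · intro h
    exact key.mp (by linarith)
  · intro h
    rw [key.mpr h]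
    norm_num

/-- The distance vanishes iff the links coincide (`Re tr(U V⁻¹) = 3 ⇔ U V⁻¹ = 1`). -/
theorem su3_frobeniusDistSq_eq_zero_iff (U V : Matrix.specialUnitaryGroup (Fin 3) ℂ) :
    ∑ i, ∑ j, ‖(U : Matrix (Fin 3) (Fin 3) ℂ) i j - (V : Matrix (Fin 3) (Fin 3) ℂ) i j‖ ^ 2 = 0 ↔
      U = V := by
  rw [su3_frobeniusDistSq_eq]
  constructor
  · intro h
    have h3 : reTr (U * V⁻¹) = 3 := by linarith
    have h1 := (reTr_eq_three_iff (U * V⁻¹)).mp h3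
    exact mul_inv_eq_one.mp h1
  · rintro rfl
    rw [mul_inv_cancel, reTr_one, Fintype.card_fin]
    norm_num

/-- The special case `V = 1`: `Σᵢⱼ |Uᵢⱼ − δᵢⱼ|² = 6 − 2 Re tr U ≤ 9`. -/
theorem su3_frobeniusDistSq_one_le_nine (U : Matrix.specialUnitaryGroup (Fin 3) ℂ) :
    ∑ i, ∑ j, ‖(U : Matrix (Fin 3) (Fin 3) ℂ) i j - (1 : Matrix (Fin 3) (Fin 3) ℂ) i j‖ ^ 2 ≤ 9 := by
  have h := su3_frobeniusDistSq_le_nine U 1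
  exact h

/-- `Σᵢⱼ |Uᵢⱼ − δᵢⱼ|² = 9` iff `U` is a non-trivial centre element. -/
theorem su3_frobeniusDistSq_one_eq_nine_iff (U : Matrix.specialUnitaryGroup (Fin 3) ℂ) :
    ∑ i, ∑ j, ‖(U : Matrix (Fin 3) (Fin 3) ℂ) i j - (1 : Matrix (Fin 3) (Fin 3) ℂ) i j‖ ^ 2 = 9 ↔
      ∃ ζ : ℂ, ζ ^ 3 = 1 ∧ ζ ≠ 1 ∧
        (U : Matrix (Fin 3) (Fin 3) ℂ) = ζ • (1 : Matrix (Fin 3) (Fin 3) ℂ) := by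
  have h := su3_frobeniusDistSq_eq_nine_iff U 1
  exact h

end SpecialUnitaryThree

end Summit.Ventures.LatticeQCDFlow.Scoring
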